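import Summits.NavierStokesRegularity.NavierStokesRegularity.Theorems.ScenarioCensusRowF1SpacetimeLocus
import Summits.NavierStokesRegularity.NavierStokesRegularity.Theorems.ScenarioCensusRowF1DenseLocusRows
import HarnessLib

/-!
# LINE 32 «spacetime-locus» port, part 3/4: §9 THE KILL UPGRADE through TIME analyticity (`LocusKills q ⇒ ThickLocusKills q` for analytic scaling-homogeneous defects;
# Mityagin in dimension one BY NAME), the three defects: Lamb, vorticity, speed (`spdOf`)

Re-homed for the scenario census (typer seat ns-census-typer-1 g9; the thick cells F1βT / F1ωT / F1∣u∣T, the dense cell F1∣u∣d and the floors GTB / GVB / GFB / RFB are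
MEMBERS OF RECORD «DECIDED IN KERNEL IN FILES» of row F1 since census v1.95 (critic idea-crit-3 g8 PASS 07:50:52Z — no price; ref ns-census-ref g12 PRE-CHECK ✓ §17.9 item
63; lead-presearch label item 63); this port makes them TREE-decided): VERBATIM PORT of the NEW sections (§8–§10) of ns-idea-3 LINE 32 «spacetime-locus»,
`pub/ideators/ns-idea-3/lines/spacetime-locus/line-spacetime-locus.lean` sha16 a2ef5b2867fe7a2c (2078 l., lean check rc 0, 0 sorry; its §1–§7 = LINES 27–31 VERBATIM,
taken BY NAME from the landed liouville-socket / sharp-top / thin-top / event-socket / dense-locus ports), split for the 400-line rule into `ScenarioCensusRowF1SpacetimeLocus`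
(§8 vocabulary) → `…SpacetimeLocusTransfer` (§8 transfer + engine) → `…SpacetimeLocusKill` (§9) → `…SpacetimeLocusRows` (§10 + census KEYS).  Lean text VERBATIM in
namespace `…Theorems.ScenarioCensus.SpacetimeLocus` (the line's `…Cruxes.ScenarioCensusRowF1.SpacetimeLocusLine` re-homed) with the five predecessor namespaces opened; port
edits: the bracket lines `section Thick` / `end Thick` dropped and its `variable {F : Type*} [NormedAddCommGroup F]` repeated at the head of the two §8 parts, §8's VERBATIM
restatement of LINE 29's `volume_preimage_zoomTime` not re-declared (BY NAME), `@[conjecture]` on the residuals `BelThickSlack` / `CalmThickSlack` / `SlowThickSlack`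
(≡ `ScenarioCensus.Row_F1`, OPEN), one-line docstrings added where missing (gate lint).  Statements untouched.

No census VALUE is moved here (row F1 stays OPEN-WITH-LINE; the members become TREE-decided by name); NS regularity is NOT proved; `Row_F1` is untouched (zero
movement, `belThickSlack_iff_rowF1` / `calmThickSlack_iff_rowF1` / `slowThickSlack_iff_rowF1`); no summit statement is proved by this file. Lemmas that restate already-landed tree declarations are taken BY NAME (gate lint `dedup.landed`): `fderiv_smul_stPull_apply` = `InviscidTop.fderiv_smul_stPull_apply`, `fderiv_smul_stPull` = `InviscidTop.fderiv_smul_stPull`, `fderiv_fderiv_smul_stPull` = `InviscidTop.fderiv_fderiv_smul_stPull`, `tendsto_clm_of_tendsto_apply` = `InviscidTop.tendsto_clm_of_tendsto_apply`, `tendsto_fderiv_fderiv_apply_of_bound` = `InviscidTop.tendsto_fderiv_fderiv_apply_of_bound`, `tendsto_fderiv_fderiv_of_bound` = `InviscidTop.tendsto_fderiv_fderiv_of_bound`, `tendsto_fderiv_fderiv_of_typeI_seq_Ioo` = `InviscidTop.tendsto_fderiv_fderiv_of_typeI_seq_Ioo`, `fderiv3_smul_stPull` = `FrozenTop.fderiv3_smul_stPull`,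 `tendsto_fderiv3_of_typeI_seq_Ioo` = `FrozenTop.tendsto_fderiv3_of_typeI_seq_Ioo`, `tendsto_physicalTime` = `ColumnarTop.tendsto_physicalTime`, `eventually_fast` = `ColumnarTop.eventually_fast`, `sqrt_timeLag` = `StretchedTop.sqrt_timeLag`, `forall_of_forall_ne_zero` = `StretchedTop.forall_of_forall_ne_zero`, `radius_eq` = `FrozenTop.radius_eq`, `jointCond_everywhere₆` = `FrozenTop.jointCond_everywhere₄`, `continuousOn_quad` = `IntegratedStretch.continuousOn_quad`, `sqrt_nu_timeLag` = `IntegratedStretch.sqrt_nu_timeLag`, `sing_of_not_bounded` = `InviscidTop.sing_of_not_bounded`, `exists_singularZoom_package₃` = `FrozenTop.exists_singularZoom_package₃`, `lapD_eq_zero_of_eq_zero` = `FrozenTop.lapD_eq_zero_of_eq_zero`, `measurableSet_top` = `IntegratedStretch.measurableSet_top`.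
-/

-- the summit and its single problem share the name `NavierStokesRegularity` (D-0017 nested layout)
set_option linter.dupNamespace false

noncomputable section

open MeasureTheory Set Function Filter TopologicalSpace Metric
open scoped Topology NNReal ENNReal InnerProductSpace RealInnerProductSpace Laplacian

namespace Summit.NavierStokesRegularity.NavierStokesRegularity.Theorems.ScenarioCensus.SpacetimeLocus

open Literature.Analysis Literature.Analysis.FluidPDE
open Summit.NavierStokesRegularity.NavierStokesRegularity.Theorems
open Summit.NavierStokesRegularity.NavierStokesRegularity.Theorems.ScenarioCensus.LiouvilleSocket
open Summit.NavierStokesRegularity.NavierStokesRegularity.Theorems.ScenarioCensus.SharpTop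
open Summit.NavierStokesRegularity.NavierStokesRegularity.Theorems.ScenarioCensus.ThinTop
open Summit.NavierStokesRegularity.NavierStokesRegularity.Theorems.ScenarioCensus.EventSocket
open Summit.NavierStokesRegularity.NavierStokesRegularity.Theorems.ScenarioCensus.DenseLocus

/-! ## §9 THE KILL UPGRADE through TIME analyticity: `LocusKills q ⇒ ThickLocusKills q` for analytic,
scaling-homogeneous defects; and the SPEED defect, which kills by analyticity ALONE -/

/-! ### Time analyticity of the raw jet of `𝒦` at a fixed point -/

/-- The raw (un-normalised) jet of `W` at the point `y`, as a function of the similarity time. -/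
def rawJet (W : ℝ → E3 → E3) (y : E3) (s : ℝ) : Jet :=
  (W s y, fderiv ℝ (W s) y)

/-- The ancient jet is the raw jet rescaled by the POSITIVE factors `√(−s)`, `−s`. -/
theorem ancientJet_eq_rawJet (W : ℝ → E3 → E3) (s : ℝ) (y : E3) :
    ancientJet W s y = (Real.sqrt (-s) • (rawJet W y s).1, (-s) • (rawJet W y s).2) := rfl

/-- The slice gradient of `𝒦` is the space–time gradient composed with the inclusion `z ↦ (0, z)`. -/
theorem fderiv_slice_eq_comp_inr {M : ℝ} {W : ℝ → E3 → E3} (hW : IsTypeIAncientMild M W) {s : ℝ} (hs : s < 0)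
    (y : E3) : fderiv ℝ (W s) y = (fderiv ℝ (uncurry W) (s, y)).comp (ContinuousLinearMap.inr ℝ ℝ E3) := by
  have hd : DifferentiableAt ℝ (uncurry W) (s, y) := (hW.analyticAt_uncurry hs y).differentiableAt
  have h2 : HasFDerivAt (fun z : E3 => ((s, z) : ℝ × E3)) (ContinuousLinearMap.inr ℝ ℝ E3) y :=
    hasFDerivAt_prodMk_right s y
  exact (hd.hasFDerivAt.comp y h2).fderiv

/-- **The raw jet of a field of `𝒦` is real-analytic in the similarity time**: the value signal by the tree theorem
`IsTypeIAncientMild.analyticAt_time` (BY NAME); the GRADIENT signal by the joint analyticity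
`IsTypeIAncientMild.analyticAt_uncurry` composed with the section `σ ↦ (σ, y)`, `AnalyticAt.fderiv`, and the slice
chain rule above. -/
theorem analyticAt_rawJet {M : ℝ} {W : ℝ → E3 → E3} (hW : IsTypeIAncientMild M W) (y : E3) {s : ℝ} (hs : s < 0) :
    AnalyticAt ℝ (rawJet W y) s := by
  have hin : AnalyticAt ℝ (fun σ : ℝ => ((σ, y) : ℝ × E3)) s := analyticAt_id.prod analyticAt_const
  have h1 : AnalyticAt ℝ (fun σ : ℝ => W σ y) s := hW.analyticAt_time hs y
  let Φ : ((ℝ × E3) →L[ℝ] E3) →L[ℝ] (E3 →L[ℝ] E3) :=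
    (ContinuousLinearMap.compL ℝ E3 (ℝ × E3) E3).flip (ContinuousLinearMap.inr ℝ ℝ E3)
  have h2i : AnalyticAt ℝ (fun σ : ℝ => fderiv ℝ (uncurry W) (σ, y)) s := by
    have h := AnalyticAt.comp (x := s) (f := fun σ : ℝ => ((σ, y) : ℝ × E3)) (g := fderiv ℝ (uncurry W))
      ((hW.analyticAt_uncurry hs y).fderiv) hin
    simpa [Function.comp_def] using h
  have h2' : AnalyticAt ℝ (fun σ : ℝ => Φ (fderiv ℝ (uncurry W) (σ, y))) s := by
    have h := AnalyticAt.comp (x := s) (f := fun σ : ℝ => fderiv ℝ (uncurry W) (σ, y)) (g := fun A => Φ A)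
      (Φ.analyticAt _) h2i
    simpa [Function.comp_def] using h
  have hev : (fun σ : ℝ => Φ (fderiv ℝ (uncurry W) (σ, y))) =ᶠ[𝓝 s] fun σ => fderiv ℝ (W σ) y := by
    filter_upwards [Iio_mem_nhds hs] with σ hσ
    rw [fderiv_slice_eq_comp_inr hW hσ y]
    simp only [Φ, ContinuousLinearMap.flip_apply, ContinuousLinearMap.compL_apply]
  exact h1.prod (h2'.congr hev)

/-- The slice map `y ↦ ancientJet W s y` of a field of `𝒦` is real-analytic (`s < 0`). -/
theorem analyticAt_ancientJet_slice {M : ℝ} {W : ℝ → E3 → E3} (hW : IsTypeIAncientMild M W) {s : ℝ} (hs : s < 0)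
    (y : E3) : AnalyticAt ℝ (fun z => ancientJet W s z) y := by
  have h1 : AnalyticAt ℝ (W s) y := analyticAt_slice hW hs y
  have h2 : AnalyticAt ℝ (fderiv ℝ (W s)) y := (analyticOnNhd_slice hW hs).fderiv y (mem_univ _)
  exact ((analyticAt_const (v := Real.sqrt (-s))).smul h1).prod ((analyticAt_const (v := -s)).smul h2)

/-! ### Mityagin in dimension one, vector-valued (the tree's `volume_zeroSet_null_real`, componentwise) -/

/-- An `ℝ³`-valued function real-analytic on a preconnected set of reals whose zero set there has NON-ZERO measure
vanishes on the whole set. -/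
theorem eq_zero_of_analyticOnNhd_real {g : ℝ → E3} {I : Set ℝ} (hI : IsPreconnected I) (hg : AnalyticOnNhd ℝ g I)
    (hZ : volume {t ∈ I | g t = 0} ≠ 0) : ∀ t ∈ I, g t = 0 := by
  have hcomp : ∀ i : Fin 3, ∀ t ∈ I, g t i = 0 := by
    intro i
    by_contra hne
    push Not at hne
    obtain ⟨t₀, ht₀, h0⟩ := hne
    have hA : AnalyticOnNhd ℝ (fun t => g t i) I := by
      have h := (EuclideanSpace.proj (𝕜 := ℝ) i).comp_analyticOnNhd hg
      simpa [Function.comp_def] using h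
    have hnull := Literature.Analysis.Calculus.Mityagin2015.volume_zeroSet_null_real hI hA ⟨t₀, ht₀, h0⟩
    refine hZ (measure_mono_null (fun t ht => ?_) hnull)
    refine ⟨ht.1, ?_⟩
    have h' : g t = 0 := ht.2
    simp only [h']
    rfl
  intro t ht
  ext i
  exact hcomp i t ht

/-! ### The upgrade -/

/-- **KILL UPGRADE.**  If the defect `q : Jet → ℝ³` is real-analytic, its zero locus is invariant under the positive
rescalings `(V, A) ↦ (aV, bA)`, and `q` KILLS (LINE 31's interface: non-null locus on EVERY slice ⇒ trivial), then `q`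
THICK-KILLS (non-null locus on a NON-NULL SET of slices ⇒ trivial).  Proof: on each such slice Mityagin (in `y`)
makes the locus the whole slice; then for each fixed `y` the function `s ↦ q(rawJet W y s)` is real-analytic on
`(−∞, 0)` (time analyticity of `𝒦`) and vanishes on a non-null set of `s`, hence (Mityagin in `s`) for every `s < 0`:
the locus is everything on every slice, and `q` kills. -/
theorem thickLocusKills_of_locusKills {q : Jet → E3} (hqa : ∀ J : Jet, AnalyticAt ℝ q J)
    (hq0 : ∀ a b : ℝ, 0 < a → 0 < b → ∀ J : Jet, q (a • J.1, b • J.2) = 0 ↔ q J = 0) (hK : LocusKills q) :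
    ThickLocusKills q := by
  intro M W hW hpos
  -- (i) a slice with non-null locus has the whole slice as locus
  have hslice : ∀ s < (0 : ℝ), volume {y : E3 | q (ancientJet W s y) = 0} ≠ 0 → ∀ y, q (ancientJet W s y) = 0 := by
    intro s hs hvol
    have han : AnalyticOnNhd ℝ (fun y => q (ancientJet W s y)) univ :=
      fun y _ => (hqa _).comp (analyticAt_ancientJet_slice hW hs y)
    exact eq_zero_of_analytic_of_volume_zeroSet_ne_zero han hvol
  -- (ii) time analyticity spreads the vanishing to every slice
  have hall : ∀ s < (0 : ℝ), ∀ y, q (ancientJet W s y) = 0 := by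
    intro s hs y
    have hg : AnalyticOnNhd ℝ (fun σ => q (rawJet W y σ)) (Iio 0) :=
      fun σ hσ => (hqa _).comp (analyticAt_rawJet hW y hσ)
    have hsub : {s : ℝ | s < 0 ∧ volume {y : E3 | q (ancientJet W s y) = 0} ≠ 0} ⊆
        {σ ∈ Iio (0 : ℝ) | q (rawJet W y σ) = 0} := by
      intro σ hσ
      have hσ0 : σ < 0 := hσ.1
      have h1 := hslice σ hσ0 hσ.2 y
      rw [ancientJet_eq_rawJet] at h1
      exact ⟨hσ0, (hq0 _ _ (Real.sqrt_pos.2 (neg_pos.2 hσ0)) (neg_pos.2 hσ0) (rawJet W y σ)).1 h1⟩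
    have hZ : volume {σ ∈ Iio (0 : ℝ) | q (rawJet W y σ) = 0} ≠ 0 := fun h0 => hpos (measure_mono_null hsub h0)
    have h2 := eq_zero_of_analyticOnNhd_real isPreconnected_Iio hg hZ s hs
    rw [ancientJet_eq_rawJet]
    exact (hq0 _ _ (Real.sqrt_pos.2 (neg_pos.2 hs)) (neg_pos.2 hs) (rawJet W y s)).2 h2
  refine hK M W hW fun s hs h0 => ?_
  have huniv : {y : E3 | q (ancientJet W s y) = 0} = univ := eq_univ_of_forall fun y => hall s hs y
  rw [huniv] at h0
  exact (measure_ball_pos volume (0 : E3) one_pos).ne' (measure_mono_null (subset_univ _) h0)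

/-! ### The three analytic, scaling-homogeneous defects: Lamb (Beltrami locus), vorticity (irrotational locus),
SPEED (rest locus) -/

/-- The dimensionless **SPEED** of a jet: `spdOf (V, A) = V`.  On the physical jet it reads `√((T − t)/ν) · u(t,x)`;
its `ε`-near locus is the SLOW set `{|u(t,x)|² < ε² ν/(T − t)}` — the complement of LINE 29's fast set at level `ε²`. -/
def spdOf (J : Jet) : E3 := J.1

/-- The speed defect is continuous. -/
theorem continuous_spdOf : Continuous spdOf := continuous_fst

/-- The speed defect is analytic. -/
theorem analyticAt_spdOf (J : Jet) : AnalyticAt ℝ spdOf J := analyticAt_fst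

/-- The vorticity defect is analytic. -/
theorem analyticAt_vortOf (J : Jet) : AnalyticAt ℝ vortOf J := by
  have h : AnalyticAt ℝ (fun J : Jet => curlCLM J.2) J := (curlCLM.analyticAt _).comp analyticAt_snd
  refine h.congr (Eventually.of_forall fun J' => ?_)
  simp only [vortOf, curlOf_eq_curlCLM]

/-- The Lamb defect is analytic. -/
theorem analyticAt_lambOf (J : Jet) : AnalyticAt ℝ lambOf J := by
  have h1 : AnalyticAt ℝ (fun J : Jet => curlCLM J.2) J := (curlCLM.analyticAt _).comp analyticAt_snd
  have h : AnalyticAt ℝ (fun J : Jet => crossCLM (curlCLM J.2) J.1) J :=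
    AnalyticAt.comp (x := J) (f := fun J : Jet => (curlCLM J.2, J.1)) (crossCLM.analyticAt_bilinear _)
      (h1.prod analyticAt_fst)
  refine h.congr (Eventually.of_forall fun J' => ?_)
  simp only [lambOf, crossCLM_apply, curlOf_eq_curlCLM]

/-- Physical reading of the speed defect. -/
theorem spdOf_physJet (T ν : ℝ) (u : ℝ → E3 → E3) (t : ℝ) (x : E3) :
    spdOf (physJet T ν u t x) = Real.sqrt ((T - t) / ν) • u t x := rfl

/-- The slow set: `x` is `ε`-near the rest locus iff `√((T − t)/ν) ‖u(t,x)‖ < ε`. -/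
theorem mem_eventSlice_nearEv_spdOf_iff (T ν ε t : ℝ) (u : ℝ → E3 → E3) (x : E3) :
    x ∈ eventSlice (NearEv spdOf ε) T ν u t ↔ Real.sqrt ((T - t) / ν) * ‖u t x‖ < ε := by
  rw [mem_eventSlice_nearEv_iff, spdOf_physJet, norm_smul, Real.norm_eq_abs,
    abs_of_nonneg (Real.sqrt_nonneg _)]

/-- The speed defect is scaling-homogeneous (zero set invariant). -/
theorem spdOf_scaling (a b : ℝ) (ha : 0 < a) (_hb : 0 < b) (J : Jet) : spdOf (a • J.1, b • J.2) = 0 ↔ spdOf J = 0 := by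
  simp only [spdOf, smul_eq_zero, ha.ne', false_or]

/-- The vorticity defect is scaling-homogeneous (zero set invariant). -/
theorem vortOf_scaling (a b : ℝ) (_ha : 0 < a) (hb : 0 < b) (J : Jet) :
    vortOf (a • J.1, b • J.2) = 0 ↔ vortOf J = 0 := by
  simp only [vortOf, curlOf_smul, smul_eq_zero, hb.ne', false_or]

/-- The Lamb defect is scaling-homogeneous (zero set invariant). -/
theorem lambOf_scaling (a b : ℝ) (ha : 0 < a) (hb : 0 < b) (J : Jet) :
    lambOf (a • J.1, b • J.2) = 0 ↔ lambOf J = 0 := by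
  simp only [lambOf, curlOf_smul, UnthreadedRigidity.ThreadingJets.cross_smul_smul, smul_eq_zero, (mul_pos hb ha).ne', false_or]

/-- **THE SPEED DEFECT KILLS BY ANALYTICITY ALONE** (no Liouville theorem): a non-null REST locus `{W(s,·) = 0}` on a
slice of an analytic field makes the slice vanish (Mityagin). -/
theorem locusKills_spdOf : LocusKills spdOf := by
  intro M W hW hloc s hs y
  have h := hloc s hs
  have e : {y : E3 | spdOf (ancientJet W s y) = 0} = {y : E3 | W s y = 0} := by
    ext y
    simp only [mem_setOf_eq, spdOf, ancientJet, smul_eq_zero, (Real.sqrt_pos.2 (neg_pos.2 hs)).ne', false_or]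
  rw [e] at h
  exact eq_zero_of_analytic_of_volume_zeroSet_ne_zero (analyticOnNhd_slice hW hs) h y

/-- The three THICK kills. -/
theorem thickLocusKills_spdOf : ThickLocusKills spdOf :=
  thickLocusKills_of_locusKills analyticAt_spdOf spdOf_scaling locusKills_spdOf

/-- The vorticity defect thick-kills. -/
theorem thickLocusKills_vortOf : ThickLocusKills vortOf :=
  thickLocusKills_of_locusKills analyticAt_vortOf vortOf_scaling locusKills_vortOf

/-- The Lamb defect thick-kills. -/
theorem thickLocusKills_lambOf : ThickLocusKills lambOf :=
  thickLocusKills_of_locusKills analyticAt_lambOf lambOf_scaling locusKills_lambOf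

end Summit.NavierStokesRegularity.NavierStokesRegularity.Theorems.ScenarioCensus.SpacetimeLocus

end
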